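import Mathlib.Analysis.Calculus.ParametricIntegral
import Mathlib.MeasureTheory.Integral.DominatedConvergence
import Literature.Analysis.FluidPDE.CarlemanCalculus
import Literature.Analysis.FluidPDE.EssCurry
import HarnessLib

/-!
# Time slices of space–time fields: integration by parts in space and differentiation in time

Analysis/FluidPDE support file (theorems only, no definitions of notions, no named facts) for the
formalisation of §4 (Carleman inequalities for backwards heat equations) of T. Tao,
*Quantitative bounds for critically bounded solutions to the Navier–Stokes equations*,
Proc. Sympos. Pure Math. 104 (2021) = arXiv:1908.04958v2, on the way to the named fact
`Literature.Analysis.FluidPDE.tao_quantitative_ess` (Thm. 1.2). Tao's general Carleman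
inequality (Lemma 4.1, p. 27) is a *time-pointwise* differential inequality
`∂ₜ ∫ (|∇u|² + ½F|u|²) e^g dx ≥ ∫ (½(LF)|u|² + 2D²g(∇u,∇u) - ½|Lu|²) e^g dx`, obtained by
"differentiating under the integral sign and integrating by parts" in the space variable at a
fixed time. The tree's Carleman calculus (`CarlemanCalculus.lean`, Seregin's `L₂` method) works
with space–time integrals of fields compactly supported away from the initial time; this file
supplies the complementary *slice* calculus for uncurried fields `Φ : ℝ × E → F` (time first,
frame operators `Carleman.dt`, `Carleman.dx`; namespace `TaoCarleman`):

* `contDiff_slice`, `continuous_slice`, `hasFDerivAt_slice`, `fderiv_slice_apply` — regularity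
  of the slices `x ↦ Φ (t, x)` of a field of class `Cⁿ` on an open set containing `{t} × E`, and
  `D(Φ(t, ·))(x) e = ∂ₑΦ (t, x)`;
* `integral_slice_mul_inner_dx` — **integration by parts in space at a fixed time**:
  `∫ w ⟪Φ, ∂ₑΨ⟫ (t, x) dx = -∫ ∂ₑw ⟪Φ, Ψ⟫ (t, x) dx - ∫ w ⟪∂ₑΦ, Ψ⟫ (t, x) dx` for `C¹` data with
  compactly supported slices (Mathlib's
  `integral_bilinear_hasFDerivAt_right_eq_neg_left_of_integrable` on `E`);
* `two_mul_integral_slice_mul_inner_dx_self` — the square rule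
  `2 ∫ w ⟪X, ∂ₑX⟫ (t, x) dx = -∫ ∂ₑw ‖X‖² (t, x) dx`;
* `hasDerivAt_integral_slice` — **differentiation under the integral sign in time**:
  `d/dt ∫ Φ (t, x) dx = ∫ ∂ₜΦ (t, x) dx` for `Φ` of class `C¹` on an open time strip with slices
  supported in a fixed compact set (`hasDerivAt_integral_of_dominated_loc_of_deriv_le`);
* `continuousOn_integral_slice` — continuity of `t ↦ ∫ Φ (t, x) dx` on a compact time interval
  under the same support condition (dominated convergence).

## References

* T. Tao, arXiv:1908.04958v2 (2021), §4, Lemma 4.1 and its proof, pp. 27–28 ("differentiating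
  under the integral sign and integrating by parts"). [Tao2021QuantitativeNS]
-/

noncomputable section

open MeasureTheory Set Function Filter Topology Metric
open scoped InnerProductSpace RealInnerProductSpace

namespace Literature.Analysis.FluidPDE

namespace TaoCarleman

open Carleman

/-! ### Regularity of slices -/

section SliceRegularity

variable {E : Type*} [NormedAddCommGroup E] [InnerProductSpace ℝ E]
variable {G : Type*} [NormedAddCommGroup G] [NormedSpace ℝ G]

/-- A slice of a field of class `Cⁿ` on a set containing `{t} × E` is of class `Cⁿ`. [folklore] -/
theorem contDiff_slice {S : Set (ℝ × E)} {Φ : ℝ × E → G} {n : WithTop ℕ∞} {t : ℝ}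
    (hΦ : ContDiffOn ℝ n Φ S) (ht : ∀ x : E, (t, x) ∈ S) : ContDiff ℝ n fun x => Φ (t, x) :=
  hΦ.comp_contDiff (contDiff_const.prodMk contDiff_id) ht

omit [InnerProductSpace ℝ E] [NormedSpace ℝ G] in
/-- A slice of a field continuous on a set containing `{t} × E` is continuous. [folklore] -/
theorem continuous_slice {S : Set (ℝ × E)} {Φ : ℝ × E → G} {t : ℝ} (hΦ : ContinuousOn Φ S)
    (ht : ∀ x : E, (t, x) ∈ S) : Continuous fun x => Φ (t, x) :=
  hΦ.comp_continuous (continuous_const.prodMk continuous_id) ht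

/-- The slice of a field differentiable at `(t, x)` has derivative `DΦ(t, x) ∘ (0, ·)` at `x`. [folklore] -/
theorem hasFDerivAt_slice {Φ : ℝ × E → G} {t : ℝ} {x : E} (hΦ : DifferentiableAt ℝ Φ (t, x)) :
    HasFDerivAt (fun y => Φ (t, y)) ((fderiv ℝ Φ (t, x)).comp (ContinuousLinearMap.inr ℝ ℝ E)) x :=
  hΦ.hasFDerivAt.comp x (hasFDerivAt_prodMk_right (𝕜 := ℝ) t x)

/-- `D(Φ(t, ·))(x) e = ∂ₑΦ (t, x)` at points of differentiability. [folklore] -/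
theorem fderiv_slice_apply {Φ : ℝ × E → G} {t : ℝ} {x : E} (hΦ : DifferentiableAt ℝ Φ (t, x))
    (e : E) : fderiv ℝ (fun y => Φ (t, y)) x e = dx e Φ (t, x) := by
  rw [(hasFDerivAt_slice hΦ).fderiv, dx_apply]
  simp

/-- On an open set, a `Cⁿ` field, `n ≠ 0`, is differentiable. [folklore] -/
theorem differentiableAt_of_contDiffOn {S : Set (ℝ × E)} (hS : IsOpen S) {Φ : ℝ × E → G}
    {n : WithTop ℕ∞} (hΦ : ContDiffOn ℝ n Φ S) (hn : n ≠ 0) {z : ℝ × E} (hz : z ∈ S) :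
    DifferentiableAt ℝ Φ z :=
  (hΦ.differentiableOn hn).differentiableAt (hS.mem_nhds hz)

/-- On an open set, a directional derivative of a `Cⁿ⁺¹` field is `Cⁿ`. [folklore] -/
theorem contDiffOn_fderiv_apply_const {S : Set (ℝ × E)} (hS : IsOpen S) {Φ : ℝ × E → G}
    {m n : WithTop ℕ∞} (hΦ : ContDiffOn ℝ n Φ S) (hmn : m + 1 ≤ n) (w : ℝ × E) :
    ContDiffOn ℝ m (fun z => fderiv ℝ Φ z w) S :=
  (hΦ.fderiv_of_isOpen hS hmn).clm_apply contDiffOn_const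

/-- On an open set, `∂ₑ` of a `Cⁿ⁺¹` field is `Cⁿ`. [folklore] -/
theorem contDiffOn_dx {S : Set (ℝ × E)} (hS : IsOpen S) {Φ : ℝ × E → G} {m n : WithTop ℕ∞}
    (hΦ : ContDiffOn ℝ n Φ S) (hmn : m + 1 ≤ n) (e : E) : ContDiffOn ℝ m (dx e Φ) S :=
  contDiffOn_fderiv_apply_const hS hΦ hmn _

/-- On an open set, `∂ₜ` of a `Cⁿ⁺¹` field is `Cⁿ`. [folklore] -/
theorem contDiffOn_dt {S : Set (ℝ × E)} (hS : IsOpen S) {Φ : ℝ × E → G} {m n : WithTop ℕ∞}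
    (hΦ : ContDiffOn ℝ n Φ S) (hmn : m + 1 ≤ n) : ContDiffOn ℝ m (dt Φ) S :=
  contDiffOn_fderiv_apply_const hS hΦ hmn _

/-- On an open set, the derivative of a `C¹` field is continuous. [folklore] -/
theorem continuousOn_fderiv_apply_const {S : Set (ℝ × E)} (hS : IsOpen S) {Φ : ℝ × E → G}
    {n : WithTop ℕ∞} (hΦ : ContDiffOn ℝ n Φ S) (hn : 1 ≤ n) (w : ℝ × E) :
    ContinuousOn (fun z => fderiv ℝ Φ z w) S :=
  (hΦ.continuousOn_fderiv_of_isOpen hS hn).clm_apply continuousOn_const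

/-- **Slices of compactly supported slices have compactly supported derivatives**: if the slice
`Φ(t, ·)` vanishes outside a compact set `K` for all times of an open strip, then so does every
directional derivative of `Φ` (the field vanishes on the open set `strip ∩ (ℝ × Kᶜ)`). [folklore] -/
theorem fderiv_eq_zero_of_slice_support {a b : ℝ} {K : Set E} (hK : IsClosed K) {Φ : ℝ × E → G}
    (hsupp : ∀ s ∈ Ioo a b, ∀ x ∉ K, Φ (s, x) = 0) {s : ℝ} (hs : s ∈ Ioo a b) {x : E}
    (hx : x ∉ K) : fderiv ℝ Φ (s, x) = 0 := by
  have hev : Φ =ᶠ[𝓝 (s, x)] fun _ => 0 := by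
    have ho : IsOpen (Ioo a b ×ˢ Kᶜ) := isOpen_Ioo.prod hK.isOpen_compl
    filter_upwards [ho.mem_nhds (mk_mem_prod hs hx)] with z hz
    exact hsupp z.1 hz.1 z.2 hz.2
  rw [hev.fderiv_eq]
  exact fderiv_const_apply _

/-- Under the slice support condition, the slices of `z ↦ DΦ(z) w` are supported in `K`. [folklore] -/
theorem fderiv_apply_slice_support {a b : ℝ} {K : Set E} (hK : IsClosed K) {Φ : ℝ × E → G}
    (hsupp : ∀ s ∈ Ioo a b, ∀ x ∉ K, Φ (s, x) = 0) (w : ℝ × E) :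
    ∀ s ∈ Ioo a b, ∀ x ∉ K, fderiv ℝ Φ (s, x) w = 0 := fun s hs x hx => by
  rw [fderiv_eq_zero_of_slice_support hK hsupp hs hx]
  rfl

omit [InnerProductSpace ℝ E] [NormedSpace ℝ G] in
/-- A slice vanishing outside a compact set has compact support. [folklore] -/
theorem hasCompactSupport_slice {K : Set E} (hK : IsCompact K) {Φ : ℝ × E → G} {s : ℝ}
    (hsupp : ∀ x ∉ K, Φ (s, x) = 0) : HasCompactSupport fun x => Φ (s, x) :=
  HasCompactSupport.intro hK fun x hx => hsupp x hx

end SliceRegularity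

/-! ### Integration by parts in space at a fixed time -/

section SliceIBP

variable {E : Type*} [NormedAddCommGroup E] [InnerProductSpace ℝ E] [FiniteDimensional ℝ E]
  [MeasurableSpace E] [BorelSpace E]
variable {F : Type*} [NormedAddCommGroup F] [InnerProductSpace ℝ F]

omit [InnerProductSpace ℝ E] [FiniteDimensional ℝ E] [MeasurableSpace E] [BorelSpace E] in
/-- A weighted pairing is compactly supported when its left field is. [folklore] -/
theorem hasCompactSupport_mul_inner_of_left {α : Type*} [TopologicalSpace α] {c : α → ℝ}
    {Φ X : α → F} (hΦ : HasCompactSupport Φ) : HasCompactSupport fun x => c x * ⟪Φ x, X x⟫ :=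
  hΦ.mono fun x hx => by
    contrapose! hx
    simp [notMem_support.1 hx]

omit [InnerProductSpace ℝ E] [FiniteDimensional ℝ E] [MeasurableSpace E] [BorelSpace E] in
/-- A weighted pairing is compactly supported when its right field is. [folklore] -/
theorem hasCompactSupport_mul_inner_of_right {α : Type*} [TopologicalSpace α] {c : α → ℝ}
    {X Ψ : α → F} (hΨ : HasCompactSupport Ψ) : HasCompactSupport fun x => c x * ⟪X x, Ψ x⟫ :=
  hΨ.mono fun x hx => by
    contrapose! hx
    simp [notMem_support.1 hx]

omit [InnerProductSpace ℝ E] [FiniteDimensional ℝ E] [MeasurableSpace E] [BorelSpace E]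
  [InnerProductSpace ℝ F] in
/-- A weighted square is compactly supported when the field is. [folklore] -/
theorem hasCompactSupport_mul_norm_sq' {α : Type*} [TopologicalSpace α] {c : α → ℝ}
    {X : α → F} (hX : HasCompactSupport X) : HasCompactSupport fun x => c x * ‖X x‖ ^ 2 :=
  hX.mono fun x hx => by
    contrapose! hx
    simp [notMem_support.1 hx]

/-- **Integration by parts in space at a fixed time** (weighted inner-product form). Let `S` be an
open subset of space–time containing the slice `{t} × E`, let `w : ℝ × E → ℝ` and
`Φ, Ψ : ℝ × E → F` be of class `C¹` on `S`, and assume that the slices `Φ(t, ·)`, `Ψ(t, ·)` are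
compactly supported. Then for every direction `e`,
`∫ w ⟪Φ, ∂ₑΨ⟫ (t, x) dx = -∫ ∂ₑw ⟪Φ, Ψ⟫ (t, x) dx - ∫ w ⟪∂ₑΦ, Ψ⟫ (t, x) dx`
(no boundary terms; Mathlib's `integral_bilinear_hasFDerivAt_right_eq_neg_left_of_integrable`
on `E` for the pair `((wΦ)(t, ·), Ψ(t, ·))`). This is the integration by parts "in space" used
at each fixed time in the proof of Tao's Lemma 4.1. [cite: Tao2021QuantitativeNS, Lemma 4.1 (proof, p. 27)] -/
theorem integral_slice_mul_inner_dx {S : Set (ℝ × E)} (hS : IsOpen S) {t : ℝ}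
    (ht : ∀ x : E, (t, x) ∈ S) {w : ℝ × E → ℝ} {Φ Ψ : ℝ × E → F} (hw : ContDiffOn ℝ 1 w S)
    (hΦ : ContDiffOn ℝ 1 Φ S) (hΨ : ContDiffOn ℝ 1 Ψ S)
    (hΦc : HasCompactSupport fun x => Φ (t, x)) (hΨc : HasCompactSupport fun x => Ψ (t, x))
    (e : E) :
    ∫ x, w (t, x) * ⟪Φ (t, x), dx e Ψ (t, x)⟫ =
      -(∫ x, dx e w (t, x) * ⟪Φ (t, x), Ψ (t, x)⟫) - ∫ x, w (t, x) * ⟪dx e Φ (t, x), Ψ (t, x)⟫ := by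
  -- slices and their regularity
  set f : E → F := fun x => w (t, x) • Φ (t, x) with hf
  set g : E → F := fun x => Ψ (t, x) with hg
  have cw : Continuous fun x => w (t, x) := continuous_slice hw.continuousOn ht
  have cΦ : Continuous fun x => Φ (t, x) := continuous_slice hΦ.continuousOn ht
  have cΨ : Continuous fun x => Ψ (t, x) := continuous_slice hΨ.continuousOn ht
  have cdw : Continuous fun x => dx e w (t, x) :=
    continuous_slice (continuousOn_fderiv_apply_const hS hw le_rfl (0, e)) ht
  have cdΦ : Continuous fun x => dx e Φ (t, x) :=
    continuous_slice (continuousOn_fderiv_apply_const hS hΦ le_rfl (0, e)) ht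
  have cdΨ : Continuous fun x => dx e Ψ (t, x) :=
    continuous_slice (continuousOn_fderiv_apply_const hS hΨ le_rfl (0, e)) ht
  have dw : ∀ x, DifferentiableAt ℝ w (t, x) := fun x =>
    differentiableAt_of_contDiffOn hS hw one_ne_zero (ht x)
  have dΦ : ∀ x, DifferentiableAt ℝ Φ (t, x) := fun x =>
    differentiableAt_of_contDiffOn hS hΦ one_ne_zero (ht x)
  have dΨ : ∀ x, DifferentiableAt ℝ Ψ (t, x) := fun x =>
    differentiableAt_of_contDiffOn hS hΨ one_ne_zero (ht x)
  -- derivatives of the slices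
  set f' : E → (E →L[ℝ] F) := fun x =>
    w (t, x) • (fderiv ℝ Φ (t, x)).comp (ContinuousLinearMap.inr ℝ ℝ E) +
      ((fderiv ℝ w (t, x)).comp (ContinuousLinearMap.inr ℝ ℝ E)).smulRight (Φ (t, x)) with hf'
  set g' : E → (E →L[ℝ] F) := fun x =>
    (fderiv ℝ Ψ (t, x)).comp (ContinuousLinearMap.inr ℝ ℝ E) with hg'
  have df : ∀ x, HasFDerivAt f (f' x) x := fun x =>
    ((hasFDerivAt_slice (dw x)).smul (hasFDerivAt_slice (dΦ x)))
  have dg : ∀ x, HasFDerivAt g (g' x) x := fun x => hasFDerivAt_slice (dΨ x)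
  have hf'e : ∀ x, f' x e = w (t, x) • dx e Φ (t, x) + dx e w (t, x) • Φ (t, x) := fun x => by
    simp [hf', dx_apply]
  have hg'e : ∀ x, g' x e = dx e Ψ (t, x) := fun x => by simp [hg', dx_apply]
  set B : F →L[ℝ] F →L[ℝ] ℝ := innerSL ℝ with hB
  have hBapp : ∀ a b : F, B a b = ⟪a, b⟫ := fun a b => rfl
  -- integrability of the three products
  have i1 : Integrable (fun x => B (f' x e) (g x)) := by
    have hc : Continuous fun x => B (f' x e) (g x) := by
      simp_rw [hBapp, hf'e]
      exact ((cw.smul cdΦ).add (cdw.smul cΦ)).inner cΨ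
    refine hc.integrable_of_hasCompactSupport (hΨc.mono fun x hx => ?_)
    contrapose! hx
    have h0 : Ψ (t, x) = 0 := notMem_support.1 hx
    simp [hBapp, hg, h0]
  have i2 : Integrable (fun x => B (f x) (g' x e)) := by
    have hc : Continuous fun x => B (f x) (g' x e) := by
      simp_rw [hBapp, hg'e, hf]
      exact (cw.smul cΦ).inner cdΨ
    refine hc.integrable_of_hasCompactSupport (hΦc.mono fun x hx => ?_)
    contrapose! hx
    have h0 : Φ (t, x) = 0 := notMem_support.1 hx
    simp [hBapp, hf, h0]
  have i3 : Integrable (fun x => B (f x) (g x)) := by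
    have hc : Continuous fun x => B (f x) (g x) := by
      simp_rw [hBapp, hf, hg]
      exact (cw.smul cΦ).inner cΨ
    refine hc.integrable_of_hasCompactSupport (hΦc.mono fun x hx => ?_)
    contrapose! hx
    have h0 : Φ (t, x) = 0 := notMem_support.1 hx
    simp [hBapp, hf, h0]
  have key := integral_bilinear_hasFDerivAt_right_eq_neg_left_of_integrable (μ := volume)
    (B := B) i1 i2 i3 (fun x _ => df x) (fun x _ => dg x)
  -- rewrite both sides
  have lhs : ∫ x, B (f x) (g' x e) = ∫ x, w (t, x) * ⟪Φ (t, x), dx e Ψ (t, x)⟫ :=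
    integral_congr_ae (Eventually.of_forall fun x => by
      simp only [hBapp, hf, hg'e, real_inner_smul_left])
  have j1 : Integrable fun x => w (t, x) * ⟪dx e Φ (t, x), Ψ (t, x)⟫ :=
    ((cw.mul (cdΦ.inner cΨ))).integrable_of_hasCompactSupport
      (hasCompactSupport_mul_inner_of_right hΨc)
  have j2 : Integrable fun x => dx e w (t, x) * ⟪Φ (t, x), Ψ (t, x)⟫ :=
    ((cdw.mul (cΦ.inner cΨ))).integrable_of_hasCompactSupport
      (hasCompactSupport_mul_inner_of_right hΨc)
  have rhs : ∫ x, B (f' x e) (g x) =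
      (∫ x, w (t, x) * ⟪dx e Φ (t, x), Ψ (t, x)⟫) + ∫ x, dx e w (t, x) * ⟪Φ (t, x), Ψ (t, x)⟫ := by
    rw [← integral_add j1 j2]
    refine integral_congr_ae (Eventually.of_forall fun x => ?_)
    simp only [hBapp, hf'e, hg, inner_add_left, real_inner_smul_left]
  rw [← lhs, key, rhs]
  ring

/-- **Square rule in space at a fixed time**: `2 ∫ w ⟪X, ∂ₑX⟫ (t, x) dx = -∫ ∂ₑw ‖X‖² (t, x) dx`
for a weight `w` and a field `X` of class `C¹` on an open set containing `{t} × E`, the slice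
`X(t, ·)` being compactly supported. [folklore] -/
theorem two_mul_integral_slice_mul_inner_dx_self {S : Set (ℝ × E)} (hS : IsOpen S) {t : ℝ}
    (ht : ∀ x : E, (t, x) ∈ S) {w : ℝ × E → ℝ} {X : ℝ × E → F} (hw : ContDiffOn ℝ 1 w S)
    (hX : ContDiffOn ℝ 1 X S) (hXc : HasCompactSupport fun x => X (t, x)) (e : E) :
    2 * ∫ x, w (t, x) * ⟪X (t, x), dx e X (t, x)⟫ = -∫ x, dx e w (t, x) * ‖X (t, x)‖ ^ 2 := by
  have h := integral_slice_mul_inner_dx hS ht hw hX hX hXc hXc e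
  have e1 : ∫ x, w (t, x) * ⟪dx e X (t, x), X (t, x)⟫ = ∫ x, w (t, x) * ⟪X (t, x), dx e X (t, x)⟫ :=
    integral_congr_ae (Eventually.of_forall fun x => by
      show w (t, x) * ⟪dx e X (t, x), X (t, x)⟫ = w (t, x) * ⟪X (t, x), dx e X (t, x)⟫
      rw [real_inner_comm])
  have e2 : ∫ x, dx e w (t, x) * ⟪X (t, x), X (t, x)⟫ = ∫ x, dx e w (t, x) * ‖X (t, x)‖ ^ 2 :=
    integral_congr_ae (Eventually.of_forall fun x => by
      show dx e w (t, x) * ⟪X (t, x), X (t, x)⟫ = dx e w (t, x) * ‖X (t, x)‖ ^ 2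
      rw [real_inner_self_eq_norm_sq])
  rw [e1] at h
  linarith

end SliceIBP

/-! ### Differentiation under the integral sign and continuity in time -/

section SliceTime

variable {E : Type*} [NormedAddCommGroup E] [InnerProductSpace ℝ E] [FiniteDimensional ℝ E]
  [MeasurableSpace E] [BorelSpace E]
variable {G : Type*} [NormedAddCommGroup G] [NormedSpace ℝ G]

omit [FiniteDimensional ℝ E] [MeasurableSpace E] [BorelSpace E] in
/-- The time line `s ↦ Φ (s, x)` of a field differentiable at `(s, x)` has derivative
`∂ₜΦ (s, x)` there. [folklore] -/
theorem hasDerivAt_timeLine {Φ : ℝ × E → G} {s : ℝ} {x : E} (hΦ : DifferentiableAt ℝ Φ (s, x)) :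
    HasDerivAt (fun r => Φ (r, x)) (dt Φ (s, x)) s := by
  have h : HasFDerivAt (fun r => Φ (r, x))
      ((fderiv ℝ Φ (s, x)).comp (ContinuousLinearMap.inl ℝ ℝ E)) s :=
    hΦ.hasFDerivAt.comp s (hasFDerivAt_prodMk_left (𝕜 := ℝ) s x)
  have := h.hasDerivAt
  simpa [dt_apply] using this

/-- **Differentiation under the integral sign in time.** Let `Φ : ℝ × E → G` be of class `C¹`
on the open strip `]a, b[ × E` and suppose that all its slices `Φ(s, ·)`, `a < s < b`, vanish
outside a fixed compact set `K`. Then `t ↦ ∫ Φ (t, x) dx` has derivative `∫ ∂ₜΦ (t, x) dx` at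
every `t ∈ ]a, b[` (domination by `sup |∂ₜΦ|` over a compact neighbourhood times the indicator
of `K`; Mathlib's `hasDerivAt_integral_of_dominated_loc_of_deriv_le`). This is the step
"differentiating under the integral sign" of the proof of Tao's Lemma 4.1. [cite: Tao2021QuantitativeNS, Lemma 4.1 (proof, p. 27)] -/
theorem hasDerivAt_integral_slice {a b t : ℝ} (ht : t ∈ Ioo a b) {Φ : ℝ × E → G}
    (hΦ : ContDiffOn ℝ 1 Φ (Ioo a b ×ˢ univ)) {K : Set E} (hK : IsCompact K)
    (hsupp : ∀ s ∈ Ioo a b, ∀ x ∉ K, Φ (s, x) = 0) :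
    HasDerivAt (fun s => ∫ x, Φ (s, x)) (∫ x, dt Φ (t, x)) t := by
  have hSo : IsOpen (Ioo a b ×ˢ (univ : Set E)) := isOpen_Ioo.prod isOpen_univ
  -- a compact time neighbourhood `[t - ε, t + ε] ⊆ ]a, b[`
  have hta : a < t := ht.1
  have htb : t < b := ht.2
  obtain ⟨ε, hε, hεI⟩ : ∃ ε > 0, Icc (t - ε) (t + ε) ⊆ Ioo a b := by
    refine ⟨min (t - a) (b - t) / 2, by positivity, fun s hs => ⟨?_, ?_⟩⟩
    · have h1 : min (t - a) (b - t) ≤ t - a := min_le_left _ _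
      have h3 : 0 < min (t - a) (b - t) := lt_min (by linarith) (by linarith)
      linarith [hs.1]
    · have h2 : min (t - a) (b - t) ≤ b - t := min_le_right _ _
      have h3 : 0 < min (t - a) (b - t) := lt_min (by linarith) (by linarith)
      linarith [hs.2]
  have hball : ball t ε ⊆ Ioo a b := fun s hs => hεI (by
    rw [mem_ball, Real.dist_eq] at hs
    constructor <;> linarith [abs_lt.1 hs |>.1, abs_lt.1 hs |>.2])
  -- continuity of `Φ` and `∂ₜΦ` on the strip
  have cΦ : ContinuousOn Φ (Ioo a b ×ˢ univ) := hΦ.continuousOn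
  have cdt : ContinuousOn (dt Φ) (Ioo a b ×ˢ univ) :=
    continuousOn_fderiv_apply_const hSo hΦ le_rfl (1, 0)
  -- a uniform bound of `∂ₜΦ` on `[t - ε, t + ε] × K`
  obtain ⟨M, hM⟩ : ∃ M, ∀ z ∈ Icc (t - ε) (t + ε) ×ˢ K, ‖dt Φ z‖ ≤ M :=
    (isCompact_Icc.prod hK).exists_bound_of_continuousOn
      (cdt.mono (prod_mono hεI (subset_univ _)))
  have hM0 : 0 ≤ max M 0 := le_max_right _ _
  -- the hypotheses of the dominated differentiation theorem
  have hF_meas : ∀ᶠ s in 𝓝 t, AEStronglyMeasurable (fun x => Φ (s, x)) volume := by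
    filter_upwards [isOpen_Ioo.mem_nhds ht] with s hs
    exact (continuous_slice cΦ fun x => mk_mem_prod hs (mem_univ x)).aestronglyMeasurable
  have hF_int : Integrable (fun x => Φ (t, x)) :=
    (continuous_slice cΦ fun x => mk_mem_prod ht (mem_univ x)).integrable_of_hasCompactSupport
      (hasCompactSupport_slice hK (hsupp t ht))
  have hF'_meas : AEStronglyMeasurable (fun x => dt Φ (t, x)) volume :=
    (continuous_slice cdt fun x => mk_mem_prod ht (mem_univ x)).aestronglyMeasurable
  have h_bound : ∀ᵐ x ∂(volume : Measure E), ∀ s ∈ ball t ε,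
      ‖dt Φ (s, x)‖ ≤ K.indicator (fun _ => max M 0) x := by
    refine Eventually.of_forall fun x s hs => ?_
    by_cases hx : x ∈ K
    · rw [indicator_of_mem hx]
      have hsI : s ∈ Icc (t - ε) (t + ε) := by
        rw [mem_ball, Real.dist_eq] at hs
        constructor <;> linarith [abs_lt.1 hs |>.1, abs_lt.1 hs |>.2]
      exact (hM (s, x) (mk_mem_prod hsI hx)).trans (le_max_left _ _)
    · rw [indicator_of_notMem hx]
      have h0 : dt Φ (s, x) = 0 :=
        fderiv_apply_slice_support hK.isClosed hsupp (1, 0) s (hball hs) x hx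
      rw [h0, norm_zero]
  have bound_integrable : Integrable (K.indicator fun _ : E => max M 0) (volume : Measure E) :=
    (integrableOn_const (hK.measure_lt_top (μ := volume)).ne).integrable_indicator
      hK.measurableSet
  have h_diff : ∀ᵐ x ∂(volume : Measure E), ∀ s ∈ ball t ε,
      HasDerivAt (fun r => Φ (r, x)) (dt Φ (s, x)) s :=
    Eventually.of_forall fun x s hs => hasDerivAt_timeLine
      (differentiableAt_of_contDiffOn hSo hΦ one_ne_zero (mk_mem_prod (hball hs) (mem_univ x)))
  exact (hasDerivAt_integral_of_dominated_loc_of_deriv_le (ball_mem_nhds t hε) hF_meas hF_int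
    hF'_meas h_bound bound_integrable h_diff).2

/-- **Continuity in time of slice integrals.** If `Φ` is continuous on `I × E` for a compact
time interval `I = [c, d]` and its slices vanish outside a fixed compact set `K`, then
`t ↦ ∫ Φ (t, x) dx` is continuous on `I` (dominated convergence with the bound
`sup |Φ| · 1_K`). [folklore] -/
theorem continuousOn_integral_slice {c d : ℝ} {Φ : ℝ × E → G}
    (hΦ : ContinuousOn Φ (Icc c d ×ˢ univ)) {K : Set E} (hK : IsCompact K)
    (hsupp : ∀ s ∈ Icc c d, ∀ x ∉ K, Φ (s, x) = 0) :
    ContinuousOn (fun s => ∫ x, Φ (s, x)) (Icc c d) := by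
  obtain ⟨M, hM⟩ : ∃ M, ∀ z ∈ Icc c d ×ˢ K, ‖Φ z‖ ≤ M :=
    (isCompact_Icc.prod hK).exists_bound_of_continuousOn
      (hΦ.mono (prod_mono Subset.rfl (subset_univ _)))
  have hF_meas : ∀ s ∈ Icc c d, AEStronglyMeasurable (fun x => Φ (s, x)) volume := fun s hs =>
    (continuous_slice hΦ fun x => mk_mem_prod hs (mem_univ x)).aestronglyMeasurable
  have h_bound : ∀ s ∈ Icc c d, ∀ᵐ x ∂(volume : Measure E),
      ‖Φ (s, x)‖ ≤ K.indicator (fun _ => max M 0) x := fun s hs =>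
    Eventually.of_forall fun x => by
      by_cases hx : x ∈ K
      · rw [indicator_of_mem hx]
        exact (hM (s, x) (mk_mem_prod hs hx)).trans (le_max_left _ _)
      · rw [indicator_of_notMem hx, hsupp s hs x hx, norm_zero]
  have bound_integrable : Integrable (K.indicator fun _ : E => max M 0) (volume : Measure E) :=
    (integrableOn_const (hK.measure_lt_top (μ := volume)).ne).integrable_indicator
      hK.measurableSet
  have h_cont : ∀ᵐ x ∂(volume : Measure E), ContinuousOn (fun s => Φ (s, x)) (Icc c d) :=
    Eventually.of_forall fun x =>
      hΦ.comp (continuous_id.prodMk continuous_const).continuousOn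
        fun s hs => mk_mem_prod hs (mem_univ x)
  exact continuousOn_of_dominated hF_meas h_bound bound_integrable h_cont

end SliceTime

end TaoCarleman

end Literature.Analysis.FluidPDE
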